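import Literature.Computability.Cryptography.CubicClassTable
import Literature.Computability.Complexity.CodeFPListKit
import Literature.Computability.Complexity.CodeFPStrings
import Literature.Computability.Complexity.CodeFPStringKit
import Literature.Computability.Complexity.CodeFPTableKit
import HarnessLib

/-!
# The class-group table on codes, III: the layout arithmetic and the generators

Theorem-only sequel of `CubicClassTable.lean`: the arithmetic of the position layout of an instance (`M`, `T`, `W`,
the grid index `jof`, the coin block `κof`, the exponent digits `digit` — read with the exponent capped at `T`,
`digit_eq_min`, so that a BINARY slot index is handled — the coins of a prime as a bit string, `Rint`, `tgt`) and the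
generator codes `gens` (a `flatMap` over the primes of the black-box roots mapped to the black-box prime codes) and
slots `gT`, all in pointwise `CodeFP` form.

## References

* S. Arora, B. Barak, *Computational Complexity: A Modern Approach*, CUP 2009, §1.3 (closure of polynomial
  time under composition and polynomially bounded loops). [AroraBarak2009]
* D. E. Knuth, *The Art of Computer Programming*, Vol. 2, 3rd ed., 1998, §4.6.3 (square-and-multiply). [KnuthTAOCP2]
* S. Hallgren, *Fast quantum algorithms for computing the unit group and class group of a number field*,
  STOC 2005, §4. [Hallgren2005]
* J. Buchmann, H. C. Williams, *On the infrastructure of the principal ideal class of an algebraic number field of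
  unit rank one*, Math. Comp. 50 (1988), §3. [BuchmannWilliams1988]
-/

namespace Literature.Computability.Cryptography

namespace CubicClassTable

open Literature.Computability.Complexity Literature.Computability.Complexity.CodeFP Polynomial

namespace Inst

/-! ### The layout arithmetic of an instance on codes -/

/-- `M = 2^ℓe` is computed on codes (pointwise form). [folklore] -/
theorem codeFP_M {σ : Type} {eσ : σ → List Bool} {I : σ → Inst} (hℓe : CodeFP eσ unE (fun s => (I s).ℓe)) :
    CodeFP eσ natE (fun s => (I s).M) :=
  (natPow.comp ((const eσ (2 : ℕ)).pair hℓe) :)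

/-- `T = 3 |ps|` is computed on codes, in unary. [folklore] -/
theorem codeFP_T {σ : Type} {eσ : σ → List Bool} {I : σ → Inst} (hps : CodeFP eσ (rawE natE) (fun s => (I s).ps)) :
    CodeFP eσ unE (fun s => (I s).T) :=
  ((unMulConst 3).comp ((ulength natE).comp hps) :)

/-- `W = M^T` is computed on codes. [folklore] -/
theorem codeFP_W {σ : Type} {eσ : σ → List Bool} {I : σ → Inst} (hps : CodeFP eσ (rawE natE) (fun s => (I s).ps))
    (hℓe : CodeFP eσ unE (fun s => (I s).ℓe)) : CodeFP eσ natE (fun s => (I s).W) :=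
  (natPow.comp ((codeFP_M hℓe).pair (codeFP_T hps)) :)

/-- The grid index `j` of a position is computed on codes. [folklore] -/
theorem codeFP_jof {σ : Type} {eσ : σ → List Bool} {I : σ → Inst} {v : σ → ℕ}
    (hps : CodeFP eσ (rawE natE) (fun s => (I s).ps)) (hℓe : CodeFP eσ unE (fun s => (I s).ℓe))
    (hℓy : CodeFP eσ unE (fun s => (I s).ℓy)) (hv : CodeFP eσ natE v) :
    CodeFP eσ natE (fun s => (I s).jof (v s)) :=
  (natMod.comp ((natDiv.comp (hv.pair (codeFP_W hps hℓe))).pair (natPow.comp ((const eσ (2 : ℕ)).pair hℓy))) :)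

/-- The coin block `κ` of a position is computed on codes. [folklore] -/
theorem codeFP_κof {σ : Type} {eσ : σ → List Bool} {I : σ → Inst} {v : σ → ℕ}
    (hps : CodeFP eσ (rawE natE) (fun s => (I s).ps)) (hℓe : CodeFP eσ unE (fun s => (I s).ℓe))
    (hℓy : CodeFP eσ unE (fun s => (I s).ℓy)) (hℓκ : CodeFP eσ unE (fun s => (I s).ℓκ)) (hv : CodeFP eσ natE v) :
    CodeFP eσ natE (fun s => (I s).κof (v s)) :=
  (natMod.comp ((natDiv.comp (hv.pair (natMul.comp ((codeFP_W hps hℓe).pair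
    (natPow.comp ((const eσ (2 : ℕ)).pair hℓy)))))).pair (natPow.comp ((const eσ (2 : ℕ)).pair hℓκ))) :)

/-- **The exponent digits past `T` vanish**, so that digit `t` is read with the exponent capped at `T`:
`digit v t = (E / M^{min(t, T)}) mod M`. [folklore] -/
theorem digit_eq_min (I : Inst) (v t : ℕ) : I.digit v t = (I.Eof v / I.M ^ (min t I.T)) % I.M := by
  unfold digit
  rcases le_total t I.T with h | h
  · rw [min_eq_left h]
  · rw [min_eq_right h]
    have hM : 1 ≤ I.M := Nat.one_le_two_pow
    have hE : I.Eof v < I.M ^ I.T := by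
      unfold Eof W
      exact Nat.mod_lt _ (Nat.pow_pos hM)
    have hE' : I.Eof v < I.M ^ t := lt_of_lt_of_le hE (Nat.pow_le_pow_right hM h)
    rw [Nat.div_eq_of_lt hE, Nat.div_eq_of_lt hE']

/-- **Digit `t` of the exponent part is computed on codes**, for a BINARY `t` (capped by `T` in unary,
`digit_eq_min`). [cite: AroraBarak2009, §1.3] -/
theorem codeFP_digit {σ : Type} {eσ : σ → List Bool} {I : σ → Inst} {v t : σ → ℕ}
    (hps : CodeFP eσ (rawE natE) (fun s => (I s).ps)) (hℓe : CodeFP eσ unE (fun s => (I s).ℓe))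
    (hv : CodeFP eσ natE v) (ht : CodeFP eσ natE t) :
    CodeFP eσ natE (fun s => (I s).digit (v s) (t s)) := by
  have hE : CodeFP eσ natE (fun s => (I s).Eof (v s)) := (natMod.comp (hv.pair (codeFP_W hps hℓe)) :)
  have hmin : CodeFP eσ unE (fun s => min (t s) (I s).T) := (unOfNatMin.comp ((codeFP_T hps).pair ht) :)
  have h : CodeFP eσ natE (fun s => ((I s).Eof (v s) / (I s).M ^ (min (t s) (I s).T)) % (I s).M) :=
    (natMod.comp ((natDiv.comp (hE.pair (natPow.comp ((codeFP_M hℓe).pair hmin)))).pair (codeFP_M hℓe)) :)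
  exact h.congr fun s => (digit_eq_min (I s) (v s) (t s)).symm

/-- The coins of prime `i` as a map over `[0, ℓb)`. [folklore] -/
theorem coins_eq_map (I : Inst) (v i : ℕ) :
    I.coins v i = (List.range I.ℓb).map fun q => Nat.testBit (I.κof v) (i * I.ℓb + q) := by
  unfold coins
  apply List.ext_getElem
  · simp
  · intro j h1 h2
    simp

/-- **The coins of prime `i` are computed on codes** (as a bit string, for a binary `i`). [cite: AroraBarak2009, §1.3] -/
theorem codeFP_coins {σ : Type} {eσ : σ → List Bool} {I : σ → Inst} {v i : σ → ℕ}
    (hps : CodeFP eσ (rawE natE) (fun s => (I s).ps)) (hℓe : CodeFP eσ unE (fun s => (I s).ℓe))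
    (hℓy : CodeFP eσ unE (fun s => (I s).ℓy)) (hℓκ : CodeFP eσ unE (fun s => (I s).ℓκ))
    (hℓb : CodeFP eσ unE (fun s => (I s).ℓb)) (hv : CodeFP eσ natE v) (hi : CodeFP eσ natE i) :
    CodeFP eσ strE (fun s => (I s).coins (v s) (i s)) := by
  have hκ : CodeFP eσ natE (fun s => (I s).κof (v s)) := codeFP_κof hps hℓe hℓy hℓκ hv
  have hoff : CodeFP eσ natE (fun s => i s * (I s).ℓb) := (natMul.comp (hi.pair (natOfUn.comp hℓb)) :)
  -- the bit at `q` (binary), context `(κ, i ℓb)`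
  have hbit : CodeFP (pairE (pairE natE natE) natE) bitE (fun w => Nat.testBit w.1.1 (w.1.2 + w.2)) :=
    (testBitNat.comp ((fst _ _).fst'.pair (natAdd.comp ((fst _ _).snd'.pair (snd _ _)))) :)
  have hm := map (σ := ℕ × ℕ) (eσ := pairE natE natE) (eα := natE) (eβ := bitE)
    (g := fun w => Nat.testBit w.1.1 (w.1.2 + w.2)) hbit
  have h : CodeFP eσ (rawE bitE) (fun s => (List.range (I s).ℓb).map fun q => Nat.testBit ((I s).κof (v s)) (i s * (I s).ℓb + q)) :=
    (hm.comp ((hκ.pair hoff).pair (urange.comp hℓb)) :)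
  exact (bitsToStr.comp h).congr fun s => (coins_eq_map (I s) (v s) (i s)).symm

/-- `R̂ 2^prec = r 2^{prec − k}` is computed on codes. [folklore] -/
theorem codeFP_Rint {σ : Type} {eσ : σ → List Bool} {I : σ → Inst}
    (hr : CodeFP eσ natE (fun s => (I s).r)) (hk : CodeFP eσ unE (fun s => (I s).k)) (hprec : CodeFP eσ unE (fun s => (I s).prec)) :
    CodeFP eσ natE (fun s => (I s).Rint) :=
  (natMul.comp (hr.pair (natPow.comp ((const eσ (2 : ℕ)).pair (MachineA.unSub.comp (hprec.pair hk))))) :)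

/-- The integer target `t̂_j` is computed on codes. [folklore] -/
theorem codeFP_tgt {σ : Type} {eσ : σ → List Bool} {I : σ → Inst} {v : σ → ℕ}
    (hps : CodeFP eσ (rawE natE) (fun s => (I s).ps)) (hℓe : CodeFP eσ unE (fun s => (I s).ℓe))
    (hℓy : CodeFP eσ unE (fun s => (I s).ℓy)) (hr : CodeFP eσ natE (fun s => (I s).r))
    (hk : CodeFP eσ unE (fun s => (I s).k)) (hprec : CodeFP eσ unE (fun s => (I s).prec))
    (hs : CodeFP eσ unE (fun s => (I s).s)) (hv : CodeFP eσ natE v) :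
    CodeFP eσ natE (fun s => (I s).tgt (v s)) := by
  have hj : CodeFP eσ natE (fun s => (I s).jof (v s) % 2 ^ (I s).s) :=
    (natMod.comp ((codeFP_jof hps hℓe hℓy hv).pair (natPow.comp ((const eσ (2 : ℕ)).pair hs))) :)
  have he : CodeFP eσ unE (fun s => (I s).prec - (I s).k - (I s).s) := (MachineA.unSub.comp ((MachineA.unSub.comp (hprec.pair hk)).pair hs) :)
  exact (natMul.comp ((natMul.comp (hj.pair hr)).pair (natPow.comp ((const eσ (2 : ℕ)).pair he))) :)

end Inst

namespace WalkFns

variable (F : WalkFns)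

/-! ### The generators on codes -/

/-- **The generator codes are computed on codes**: `s ↦ gens (I s) (v s)` (a `flatMap` over the primes of
the roots, each mapped to its degree-one prime code). [cite: AroraBarak2009, §1.3; Hallgren2005, §4] -/
theorem codeFP_gens {σ : Type} {eσ : σ → List Bool} {I : σ → Inst} {v : σ → ℕ}
    (hroots : CodeFP (pairE natE (pairE natE strE)) (rawE natE) F.roots) (hprime : CodeFP (pairE (pairE natE natE) (pairE (pairE natE (rawE intE)) (pairE natE natE))) (pairE natE (rawE intE)) F.primeL)
    (hd : CodeFP eσ (pairE (pairE natE natE) unE) (fun s => (I s).d)) (hord : CodeFP eσ (pairE natE (rawE intE)) (fun s => (I s).ord))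
    (hm : CodeFP eσ natE (fun s => (I s).m)) (hps : CodeFP eσ (rawE natE) (fun s => (I s).ps))
    (hℓe : CodeFP eσ unE (fun s => (I s).ℓe)) (hℓy : CodeFP eσ unE (fun s => (I s).ℓy))
    (hℓκ : CodeFP eσ unE (fun s => (I s).ℓκ)) (hℓb : CodeFP eσ unE (fun s => (I s).ℓb)) (hv : CodeFP eσ natE v) :
    CodeFP eσ (rawE (pairE natE (rawE intE))) (fun s => F.gens (I s) (v s)) := by
  -- context `(s, i)`: the prime `p_i`, its roots, the prime codes above it
  have hpi : CodeFP (pairE eσ natE) natE (fun q => (I q.1).ps.getD q.2 0) :=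
    ((rawGetD natE natE_zero).comp ((hps.comp (fst _ _)).pair (snd _ _)) :)
  have hcoins : CodeFP (pairE eσ natE) strE (fun q => (I q.1).coins (v q.1) q.2) :=
    Inst.codeFP_coins (σ := σ × ℕ) (I := fun q => I q.1) (hps.comp (fst _ _)) (hℓe.comp (fst _ _)) (hℓy.comp (fst _ _))
      (hℓκ.comp (fst _ _)) (hℓb.comp (fst _ _)) (hv.comp (fst _ _)) (snd _ _)
  have hrs : CodeFP (pairE eσ natE) (rawE natE) (fun q => F.roots ((I q.1).ps.getD q.2 0, (I q.1).m, (I q.1).coins (v q.1) q.2)) :=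
    (hroots.comp (hpi.pair ((hm.comp (fst _ _)).pair hcoins)) :)
  -- context `((s, i), rt)`: one prime code
  have hab : CodeFP (pairE (pairE eσ natE) natE) (pairE natE natE) (fun w => (I w.1.1).d.1) := (hd.comp (fst _ _).fst').fst'
  have hone : CodeFP (pairE (pairE eσ natE) natE) (pairE natE (rawE intE))
      (fun w => F.primeL (((I w.1.1).a, (I w.1.1).b), ((I w.1.1).ord, ((I w.1.1).ps.getD w.1.2 0, w.2)))) :=
    (hprime.comp (hab.pair ((hord.comp (fst _ _).fst').pair ((hpi.comp (fst _ _)).pair (snd _ _)))) :)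
  have hrow : CodeFP (pairE eσ natE) (rawE (pairE natE (rawE intE))) (fun q => (F.roots ((I q.1).ps.getD q.2 0, (I q.1).m, (I q.1).coins (v q.1) q.2)).map
      fun rt => F.primeL (((I q.1).a, (I q.1).b), ((I q.1).ord, ((I q.1).ps.getD q.2 0, rt)))) :=
    ((map hone).comp ((CodeFP.id _).pair hrs) :)
  have hrows : CodeFP eσ (rawE (rawE (pairE natE (rawE intE)))) (fun s => (List.range (I s).ps.length).map fun i =>
      (F.roots ((I s).ps.getD i 0, (I s).m, (I s).coins (v s) i)).map
        fun rt => F.primeL (((I s).a, (I s).b), ((I s).ord, ((I s).ps.getD i 0, rt)))) :=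
    ((map hrow).comp ((CodeFP.id _).pair (urange.comp ((ulength natE).comp hps))) :)
  exact ((flatten (pairE natE (rawE intE))).comp hrows).congr fun s => by unfold gens; rw [List.flatMap_def]

/-- **Generator slot `t` is computed on codes** (binary `t`, default `ord`). [cite: AroraBarak2009, §1.3] -/
theorem codeFP_gT {σ : Type} {eσ : σ → List Bool} {I : σ → Inst} {v t : σ → ℕ}
    (hroots : CodeFP (pairE natE (pairE natE strE)) (rawE natE) F.roots) (hprime : CodeFP (pairE (pairE natE natE) (pairE (pairE natE (rawE intE)) (pairE natE natE))) (pairE natE (rawE intE)) F.primeL)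
    (hd : CodeFP eσ (pairE (pairE natE natE) unE) (fun s => (I s).d)) (hord : CodeFP eσ (pairE natE (rawE intE)) (fun s => (I s).ord))
    (hm : CodeFP eσ natE (fun s => (I s).m)) (hps : CodeFP eσ (rawE natE) (fun s => (I s).ps))
    (hℓe : CodeFP eσ unE (fun s => (I s).ℓe)) (hℓy : CodeFP eσ unE (fun s => (I s).ℓy))
    (hℓκ : CodeFP eσ unE (fun s => (I s).ℓκ)) (hℓb : CodeFP eσ unE (fun s => (I s).ℓb)) (hv : CodeFP eσ natE v)
    (ht : CodeFP eσ natE t) :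
    CodeFP eσ (pairE natE (rawE intE)) (fun s => F.gT (I s) (v s) (t s)) :=
  ((rawGetOr (pairE natE (rawE intE))).comp ((F.codeFP_gens hroots hprime hd hord hm hps hℓe hℓy hℓκ hℓb hv).pair (ht.pair hord)) :)

end WalkFns

end CubicClassTable

end Literature.Computability.Cryptography
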